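import Mathlib
import HarnessLib

/-!
# Crux U `FreeProbeLawG` (stmt-QuantumFields-23756), line `birth` — assembly part A1: the abstract STEIN-PAIR budget lemma

Route `SteinGapBootstrap` of `QuantumFields/YangMills` (lead `ym-line-sgb-k1-g1`), helper toward the registered stub `stub_assembly`.
HONEST LABEL: pure probability; the route serves the RECORD-label rung R2ξ-G (`WeakCouplingRates.XiPow`); nothing here bears on the
Yang–Mills mass gap.

The «energy budget kills the harmonic background» step of the line, in abstract form. On a probability space let
`X, Z : Fin D → Ω → ℝ` be bounded measurable families, `V = X + Z`, and put `w = exp(−(δ/2) Σ_b (X_b² + Z_b²))`. Suppose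
* (Stein pair, two test functions) for every colour `a`:
  `|E[Z_a · Z_a w] − s·E[w − δ Z_a² w]| ≤ η` and `|E[Z_a · X_a w] + s δ·E[X_a Z_a w]| ≤ η`
  (in the line: `Z_a = ⟨dω, Y^a⟩` is the Green-resummed part of the plaquette field, and these are the single-edge Schwinger–Dyson
  identities of the limit state resummed against the truncated Green `1`-form, `s = curvatureTwoPoint p p`);
* (budget) `E Σ_a V_a² ≤ D s + ε_b` (sharp equipartition at rate);
* (crude moments) `E Σ_a (X_a² + Z_a²) ≤ Λ`.
Then `E Σ_a X_a² w ≤ ε_b + 3 D η + s δ Λ (D/2 + 1)` (`integral_sq_weight_le`) and, for every `λ > 0` and colour `a`,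
`E|X_a| ≤ λ·(ε_b + 3Dη + sδΛ(D/2+1)) + λ⁻¹ + √δ·Λ` (`integral_abs_le`): the background `X` is small in `L¹` although only its
truncated second moment is controlled. Elementary: `x² = v² − 2xz − z²`, `w ≤ 1`, `e^{−u} ≥ 1 − u`, AM–GM, and the pointwise
alternative `|x_a| ≤ e^{1/4}|x_a|√w + √δ Σ(x² + z²)`.

References: E. Meckes, *On Stein's method for multivariate normal approximation*, IMS Coll. 5 (2009), Lemma 1 [Meckes2009];
S. Chatterjee, arXiv:1602.01222, §11 (Schwinger–Dyson heuristics) [arXiv160201222].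
-/

set_option autoImplicit false

noncomputable section

open MeasureTheory Real Finset

namespace Summit.QuantumFields.YangMills.Cruxes.FreeProbeLawG.SteinFree

namespace SteinPair

section Pointwise

variable {Ω : Type*} {D : ℕ} (X Z : Fin D → Ω → ℝ)

variable {X Z}

/-! Throughout, the Gaussian weight is an arbitrary function `w` satisfying
`hw : ∀ ω, w ω = exp(−(δ/2) Σ_b (X_b ω² + Z_b ω²))` (no definition is introduced). -/

/-- The weight is positive. -/
theorem weight_pos {δ : ℝ} {w : Ω → ℝ} (hw : ∀ ω, w ω = Real.exp (-(δ / 2) * ∑ b, ((X b ω) ^ 2 + (Z b ω) ^ 2)))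
    (ω : Ω) : 0 < w ω := by
  rw [hw]; exact Real.exp_pos _

/-- `Σ_b (X_b² + Z_b²) ≥ 0`. -/
theorem sumSq_nonneg (ω : Ω) : 0 ≤ ∑ b, ((X b ω) ^ 2 + (Z b ω) ^ 2) :=
  Finset.sum_nonneg fun b _ => by positivity

/-- `w ≤ 1` for `δ ≥ 0`. -/
theorem weight_le_one {δ : ℝ} {w : Ω → ℝ} (hw : ∀ ω, w ω = Real.exp (-(δ / 2) * ∑ b, ((X b ω) ^ 2 + (Z b ω) ^ 2)))
    (hδ : 0 ≤ δ) (ω : Ω) : w ω ≤ 1 := by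
  rw [hw, ← Real.exp_zero]
  refine Real.exp_le_exp.2 ?_
  have := sumSq_nonneg (X := X) (Z := Z) ω
  nlinarith

/-- `w ≥ 1 − (δ/2) Σ (X² + Z²)`. -/
theorem one_sub_le_weight {δ : ℝ} {w : Ω → ℝ} (hw : ∀ ω, w ω = Real.exp (-(δ / 2) * ∑ b, ((X b ω) ^ 2 + (Z b ω) ^ 2)))
    (ω : Ω) : 1 - (δ / 2) * ∑ b, ((X b ω) ^ 2 + (Z b ω) ^ 2) ≤ w ω := by
  rw [hw]
  have := Real.add_one_le_exp (-(δ / 2) * ∑ b, ((X b ω) ^ 2 + (Z b ω) ^ 2))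
  linarith

/-- On `{δ Σ ≤ 1}` the weight is at least `e^{-1/2}`: `1 ≤ e^{1/4} √w`. -/
theorem one_le_exp_mul_sqrt_weight {δ : ℝ} {w : Ω → ℝ}
    (hw : ∀ ω, w ω = Real.exp (-(δ / 2) * ∑ b, ((X b ω) ^ 2 + (Z b ω) ^ 2))) (ω : Ω)
    (h : δ * ∑ b, ((X b ω) ^ 2 + (Z b ω) ^ 2) ≤ 1) :
    1 ≤ Real.exp (1 / 4) * Real.sqrt (w ω) := by
  have hw' : Real.exp (-(1 / 2)) ≤ w ω := by
    rw [hw]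
    exact Real.exp_le_exp.2 (by nlinarith)
  have h1 : Real.sqrt (Real.exp (-(1 / 2))) ≤ Real.sqrt (w ω) := Real.sqrt_le_sqrt hw'
  have h2 : Real.sqrt (Real.exp (-(1 / 2))) = Real.exp (-(1 / 4)) := by
    rw [show Real.exp (-(1 / 2)) = Real.exp (-(1 / 4)) * Real.exp (-(1 / 4)) by
      rw [← Real.exp_add]; norm_num]
    exact Real.sqrt_mul_self (Real.exp_pos _).le
  rw [h2] at h1
  calc (1 : ℝ) = Real.exp (1 / 4) * Real.exp (-(1 / 4)) := by rw [← Real.exp_add]; norm_num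
    _ ≤ Real.exp (1 / 4) * Real.sqrt (w ω) :=
        mul_le_mul_of_nonneg_left h1 (Real.exp_pos _).le

/-- The pointwise alternative: `|x_a| ≤ e^{1/4} |x_a| √w + √δ · Σ_b (x_b² + z_b²)` (first term on `{δΣ ≤ 1}`, second term off it). -/
theorem abs_le_weighted_add {δ : ℝ} {w : Ω → ℝ}
    (hw : ∀ ω, w ω = Real.exp (-(δ / 2) * ∑ b, ((X b ω) ^ 2 + (Z b ω) ^ 2))) (hδ : 0 < δ) (a : Fin D) (ω : Ω) :
    |X a ω| ≤ Real.exp (1 / 4) * (|X a ω| * Real.sqrt (w ω)) +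
      Real.sqrt δ * ∑ b, ((X b ω) ^ 2 + (Z b ω) ^ 2) := by
  set S : ℝ := ∑ b, ((X b ω) ^ 2 + (Z b ω) ^ 2) with hS
  have hS0 : 0 ≤ S := sumSq_nonneg ω
  have hXa : (X a ω) ^ 2 ≤ S := by
    rw [hS]
    have : (X a ω) ^ 2 ≤ (X a ω) ^ 2 + (Z a ω) ^ 2 := by nlinarith
    exact this.trans (Finset.single_le_sum (f := fun b => (X b ω) ^ 2 + (Z b ω) ^ 2)
      (fun b _ => by positivity) (Finset.mem_univ a))
  have hT1 : 0 ≤ Real.exp (1 / 4) * (|X a ω| * Real.sqrt (w ω)) := by positivity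
  have hT2 : 0 ≤ Real.sqrt δ * S := by positivity
  by_cases hcase : δ * S ≤ 1
  · -- first term dominates
    have h1 := one_le_exp_mul_sqrt_weight hw ω hcase
    calc |X a ω| = |X a ω| * 1 := (mul_one _).symm
      _ ≤ |X a ω| * (Real.exp (1 / 4) * Real.sqrt (w ω)) :=
          mul_le_mul_of_nonneg_left h1 (abs_nonneg _)
      _ = Real.exp (1 / 4) * (|X a ω| * Real.sqrt (w ω)) := by ring
      _ ≤ _ := le_add_of_nonneg_right hT2
  · -- second term dominates: `|x_a| ≤ √S ≤ √δ S` when `δ S > 1`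
    have hcase' : 1 < δ * S := lt_of_not_ge hcase
    have hSpos : 0 < S := by
      rcases hS0.lt_or_eq with h | h
      · exact h
      · rw [← h, mul_zero] at hcase'; linarith
    have h1 : |X a ω| ≤ Real.sqrt S := Real.abs_le_sqrt hXa
    have h2 : Real.sqrt S ≤ Real.sqrt δ * S := by
      have hsq : Real.sqrt S * Real.sqrt S = S := Real.mul_self_sqrt hS0
      have hsS : 0 < Real.sqrt S := Real.sqrt_pos.2 hSpos
      have h3 : 1 ≤ Real.sqrt δ * Real.sqrt S := by
        rw [← Real.sqrt_mul hδ.le, show (1 : ℝ) = Real.sqrt 1 by simp]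
        exact Real.sqrt_le_sqrt hcase'.le
      calc Real.sqrt S = 1 * Real.sqrt S := (one_mul _).symm
        _ ≤ (Real.sqrt δ * Real.sqrt S) * Real.sqrt S := mul_le_mul_of_nonneg_right h3 hsS.le
        _ = Real.sqrt δ * S := by rw [mul_assoc, hsq]
    exact (h1.trans h2).trans (le_add_of_nonneg_left hT1)

/-- `e^{1/4} ≤ 2` (as `e < 16`). -/
theorem exp_quarter_le_two : Real.exp (1 / 4) ≤ 2 := by
  have h4 : Real.exp (1 / 4) ^ 4 = Real.exp 1 := by rw [← Real.exp_nat_mul]; norm_num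
  by_contra hc
  have hc' : 2 < Real.exp (1 / 4) := lt_of_not_ge hc
  have : (2 : ℝ) ^ 4 < Real.exp (1 / 4) ^ 4 := pow_lt_pow_left₀ hc' (by norm_num) (by norm_num)
  rw [h4] at this
  have := Real.exp_one_lt_d9
  linarith

end Pointwise

section Integral

variable {Ω : Type*} [MeasurableSpace Ω] (μ : Measure Ω) [IsProbabilityMeasure μ] {D : ℕ}
  {X Z : Fin D → Ω → ℝ}

omit [IsProbabilityMeasure μ] in
/-- The weight is measurable. -/
theorem measurable_weight (hXm : ∀ a, Measurable (X a)) (hZm : ∀ a, Measurable (Z a)) {δ : ℝ} {w : Ω → ℝ}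
    (hw : ∀ ω, w ω = Real.exp (-(δ / 2) * ∑ b, ((X b ω) ^ 2 + (Z b ω) ^ 2))) :
    Measurable w := by
  rw [show w = fun ω => Real.exp (-(δ / 2) * ∑ b, ((X b ω) ^ 2 + (Z b ω) ^ 2)) from funext hw]
  refine Real.measurable_exp.comp (measurable_const.mul ?_)
  exact Finset.measurable_sum _ fun b _ => ((hXm b).pow_const 2).add ((hZm b).pow_const 2)

/-- **Truncated second moment of the background.** Under the two Stein-pair inequalities, the budget and the crude moment
bound, `E Σ_a X_a² w ≤ ε_b + 3 D η + s δ Λ (D/2 + 1)`. -/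
theorem integral_sq_weight_le (hXm : ∀ a, Measurable (X a)) (hZm : ∀ a, Measurable (Z a))
    {B : ℝ} (hXb : ∀ a ω, |X a ω| ≤ B) (hZb : ∀ a ω, |Z a ω| ≤ B)
    {s δ η εb Λ : ℝ} (hs : 0 ≤ s) (hδ : 0 < δ) {w : Ω → ℝ}
    (hw : ∀ ω, w ω = Real.exp (-(δ / 2) * ∑ b, ((X b ω) ^ 2 + (Z b ω) ^ 2)))
    (hS1 : ∀ a, |(∫ ω, Z a ω * (Z a ω * w ω) ∂μ) -
        s * ∫ ω, (w ω - δ * (Z a ω) ^ 2 * w ω) ∂μ| ≤ η)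
    (hS2 : ∀ a, |(∫ ω, Z a ω * (X a ω * w ω) ∂μ) +
        s * δ * ∫ ω, X a ω * Z a ω * w ω ∂μ| ≤ η)
    (hbudget : ∫ ω, ∑ a, (X a ω + Z a ω) ^ 2 ∂μ ≤ D * s + εb)
    (hΛ : ∫ ω, ∑ a, ((X a ω) ^ 2 + (Z a ω) ^ 2) ∂μ ≤ Λ) :
    ∫ ω, ∑ a, (X a ω) ^ 2 * w ω ∂μ ≤ εb + 3 * D * η + s * δ * Λ * (D / 2 + 1) := by
  have hwm : Measurable w := measurable_weight hXm hZm hw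
  have hwpos : ∀ ω, 0 < w ω := weight_pos hw
  have hwle : ∀ ω, w ω ≤ 1 := fun ω => weight_le_one hw hδ.le ω
  have hw1 : ∀ ω, |w ω| ≤ 1 := fun ω => by rw [abs_of_pos (hwpos ω)]; exact hwle ω
  -- bounded measurable functions are integrable (cf. `SelfNormalisedSkewness.Negative.integrable_of_abs_le_const`)
  have integrable_of_bdd : ∀ {f : Ω → ℝ}, Measurable f → ∀ {C : ℝ}, (∀ ω, |f ω| ≤ C) → Integrable f μ :=
    fun hf C hC => Integrable.of_bound hf.aestronglyMeasurable C
      (ae_of_all _ fun ω => by rw [Real.norm_eq_abs]; exact hC ω)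
  have hX2 : ∀ a ω, (X a ω) ^ 2 ≤ B ^ 2 := fun a ω => by
    simpa only [sq_abs] using pow_le_pow_left₀ (abs_nonneg _) (hXb a ω) 2
  have hZ2 : ∀ a ω, (Z a ω) ^ 2 ≤ B ^ 2 := fun a ω => by
    simpa only [sq_abs] using pow_le_pow_left₀ (abs_nonneg _) (hZb a ω) 2
  -- integrability of everything (bounded measurable)
  have iXZw : ∀ a, Integrable (fun ω => X a ω * Z a ω * w ω) μ := fun a =>
    integrable_of_bdd (((hXm a).mul (hZm a)).mul hwm) (C := B * B * 1) fun ω => by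
      rw [abs_mul, abs_mul]
      exact mul_le_mul (mul_le_mul (hXb a ω) (hZb a ω) (abs_nonneg _) ((abs_nonneg _).trans (hXb a ω)))
        (hw1 ω) (abs_nonneg _) (mul_nonneg ((abs_nonneg _).trans (hXb a ω)) ((abs_nonneg _).trans (hZb a ω)))
  have iZZw : ∀ a, Integrable (fun ω => (Z a ω) ^ 2 * w ω) μ := fun a =>
    integrable_of_bdd (((hZm a).pow_const 2).mul hwm) (C := B ^ 2 * 1) fun ω => by
      rw [abs_mul, abs_of_nonneg (sq_nonneg _)]
      exact mul_le_mul (hZ2 a ω) (hw1 ω) (abs_nonneg _) (sq_nonneg B)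
  have iXXw : ∀ a, Integrable (fun ω => (X a ω) ^ 2 * w ω) μ := fun a =>
    integrable_of_bdd (((hXm a).pow_const 2).mul hwm) (C := B ^ 2 * 1) fun ω => by
      rw [abs_mul, abs_of_nonneg (sq_nonneg _)]
      exact mul_le_mul (hX2 a ω) (hw1 ω) (abs_nonneg _) (sq_nonneg B)
  have hV2 : ∀ a ω, (X a ω + Z a ω) ^ 2 ≤ (B + B) ^ 2 := fun a ω => by
    have := pow_le_pow_left₀ (abs_nonneg _) ((abs_add_le (X a ω) (Z a ω)).trans (add_le_add (hXb a ω) (hZb a ω))) 2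
    simpa only [sq_abs] using this
  have iVVw : ∀ a, Integrable (fun ω => (X a ω + Z a ω) ^ 2 * w ω) μ := fun a =>
    integrable_of_bdd ((((hXm a).add (hZm a)).pow_const 2).mul hwm) (C := (B + B) ^ 2 * 1) fun ω => by
      rw [abs_mul, abs_of_nonneg (sq_nonneg _)]
      exact mul_le_mul (hV2 a ω) (hw1 ω) (abs_nonneg _) (sq_nonneg _)
  have iVV : ∀ a, Integrable (fun ω => (X a ω + Z a ω) ^ 2) μ := fun a =>
    integrable_of_bdd (((hXm a).add (hZm a)).pow_const 2) (C := (B + B) ^ 2) fun ω => by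
      rw [abs_of_nonneg (sq_nonneg _)]; exact hV2 a ω
  have iSS : ∀ a, Integrable (fun ω => (X a ω) ^ 2 + (Z a ω) ^ 2) μ := fun a =>
    integrable_of_bdd (((hXm a).pow_const 2).add ((hZm a).pow_const 2)) (C := B ^ 2 + B ^ 2) fun ω => by
      rw [abs_of_nonneg (by positivity)]
      exact add_le_add (hX2 a ω) (hZ2 a ω)
  have iw : Integrable w μ := integrable_of_bdd hwm hw1
  -- (1) pointwise `x² w = v² w − 2 x z w − z² w`, integrated and summed
  have h1a : ∀ a, ∫ ω, (X a ω) ^ 2 * w ω ∂μ =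
      (∫ ω, (X a ω + Z a ω) ^ 2 * w ω ∂μ) - 2 * (∫ ω, X a ω * Z a ω * w ω ∂μ) - ∫ ω, (Z a ω) ^ 2 * w ω ∂μ := by
    intro a
    have i2 : Integrable (fun ω => 2 * (X a ω * Z a ω * w ω)) μ := (iXZw a).const_mul 2
    have i12 : Integrable (fun ω => (X a ω + Z a ω) ^ 2 * w ω - 2 * (X a ω * Z a ω * w ω)) μ := (iVVw a).sub i2
    have hpt : (fun ω => (X a ω) ^ 2 * w ω) =
        fun ω => ((X a ω + Z a ω) ^ 2 * w ω - 2 * (X a ω * Z a ω * w ω)) - (Z a ω) ^ 2 * w ω := by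
      funext ω; ring
    rw [hpt, integral_sub i12 (iZZw a), integral_sub (iVVw a) i2, integral_const_mul]
  have h1 : ∫ ω, ∑ a, (X a ω) ^ 2 * w ω ∂μ =
      (∑ a, ∫ ω, (X a ω + Z a ω) ^ 2 * w ω ∂μ) - 2 * (∑ a, ∫ ω, X a ω * Z a ω * w ω ∂μ) -
        ∑ a, ∫ ω, (Z a ω) ^ 2 * w ω ∂μ := by
    rw [integral_finsetSum _ fun a _ => iXXw a, Finset.mul_sum, ← Finset.sum_sub_distrib, ← Finset.sum_sub_distrib]
    exact Finset.sum_congr rfl fun a _ => h1a a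
  -- (2) the budget term: `Σ_a ∫ V_a² w ≤ ∫ Σ V_a² ≤ D s + εb`
  have h2 : ∑ a, ∫ ω, (X a ω + Z a ω) ^ 2 * w ω ∂μ ≤ D * s + εb := by
    refine le_trans ?_ hbudget
    rw [integral_finsetSum _ fun a _ => iVV a]
    refine Finset.sum_le_sum fun a _ => integral_mono (iVVw a) (iVV a) fun ω => ?_
    have : 0 ≤ (X a ω + Z a ω) ^ 2 := sq_nonneg _
    simpa using mul_le_mul_of_nonneg_left (hwle ω) this
  -- (3) the cross terms: `|∫ X_a Z_a w| ≤ η` from hS2 (`1 + s δ ≥ 1`)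
  have h3 : ∀ a, |∫ ω, X a ω * Z a ω * w ω ∂μ| ≤ η := by
    intro a
    have hcomm : ∫ ω, Z a ω * (X a ω * w ω) ∂μ = ∫ ω, X a ω * Z a ω * w ω ∂μ :=
      integral_congr_ae (ae_of_all _ fun ω => by ring)
    have h := hS2 a
    rw [hcomm, show (∫ ω, X a ω * Z a ω * w ω ∂μ) + s * δ * ∫ ω, X a ω * Z a ω * w ω ∂μ =
      (1 + s * δ) * ∫ ω, X a ω * Z a ω * w ω ∂μ by ring, abs_mul, abs_of_pos (by positivity)] at h
    have h1sδ : (1 : ℝ) ≤ 1 + s * δ := by nlinarith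
    calc |∫ ω, X a ω * Z a ω * w ω ∂μ| = 1 * |∫ ω, X a ω * Z a ω * w ω ∂μ| := (one_mul _).symm
      _ ≤ (1 + s * δ) * |∫ ω, X a ω * Z a ω * w ω ∂μ| := mul_le_mul_of_nonneg_right h1sδ (abs_nonneg _)
      _ ≤ η := h
  have h3' : -(2 * ∑ a, ∫ ω, X a ω * Z a ω * w ω ∂μ) ≤ 2 * (D * η) := by
    have : |∑ a, ∫ ω, X a ω * Z a ω * w ω ∂μ| ≤ D * η := by
      refine (Finset.abs_sum_le_sum_abs _ _).trans ?_
      calc ∑ a : Fin D, |∫ ω, X a ω * Z a ω * w ω ∂μ| ≤ ∑ _a : Fin D, η := Finset.sum_le_sum fun a _ => h3 a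
        _ = D * η := by simp
    have := neg_abs_le (∑ a, ∫ ω, X a ω * Z a ω * w ω ∂μ)
    linarith
  -- (4) the `Z² w` terms: `∫ Z_a² w ≥ s ∫w − s δ ∫Z_a² w − η`
  have h4 : ∀ a, s * (∫ ω, w ω ∂μ) - s * δ * (∫ ω, (Z a ω) ^ 2 * w ω ∂μ) - η ≤ ∫ ω, (Z a ω) ^ 2 * w ω ∂μ := by
    intro a
    have h := hS1 a
    have hA : ∫ ω, Z a ω * (Z a ω * w ω) ∂μ = ∫ ω, (Z a ω) ^ 2 * w ω ∂μ :=
      integral_congr_ae (ae_of_all _ fun ω => by ring)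
    have hB : ∫ ω, (w ω - δ * (Z a ω) ^ 2 * w ω) ∂μ = (∫ ω, w ω ∂μ) - δ * ∫ ω, (Z a ω) ^ 2 * w ω ∂μ := by
      have iδ : Integrable (fun ω => δ * ((Z a ω) ^ 2 * w ω)) μ := (iZZw a).const_mul δ
      have hpt : (fun ω => w ω - δ * (Z a ω) ^ 2 * w ω) = fun ω => w ω - δ * ((Z a ω) ^ 2 * w ω) := by
        funext ω; ring
      rw [hpt, integral_sub iw iδ, integral_const_mul]
    rw [hA, hB] at h
    have key := (abs_le.1 h).1
    have hring : s * ((∫ ω, w ω ∂μ) - δ * ∫ ω, (Z a ω) ^ 2 * w ω ∂μ) =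
        s * (∫ ω, w ω ∂μ) - s * δ * ∫ ω, (Z a ω) ^ 2 * w ω ∂μ := by ring
    rw [hring] at key
    linarith
  have hwint : 1 - δ / 2 * Λ ≤ ∫ ω, w ω ∂μ := by
    have iS : Integrable (fun ω => ∑ b, ((X b ω) ^ 2 + (Z b ω) ^ 2)) μ := integrable_finsetSum _ fun b _ => iSS b
    have iL : Integrable (fun ω => 1 - (δ / 2) * ∑ b, ((X b ω) ^ 2 + (Z b ω) ^ 2)) μ :=
      (integrable_const _).sub (iS.const_mul _)
    have hI : ∫ ω, (1 - (δ / 2) * ∑ b, ((X b ω) ^ 2 + (Z b ω) ^ 2)) ∂μ ≤ ∫ ω, w ω ∂μ :=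
      integral_mono iL iw fun ω => one_sub_le_weight hw ω
    have hE : ∫ ω, (1 - (δ / 2) * ∑ b, ((X b ω) ^ 2 + (Z b ω) ^ 2)) ∂μ =
        1 - (δ / 2) * ∫ ω, ∑ b, ((X b ω) ^ 2 + (Z b ω) ^ 2) ∂μ := by
      rw [integral_sub (integrable_const _) (iS.const_mul _), integral_const, integral_const_mul]
      simp
    rw [hE] at hI
    have hδΛ : δ / 2 * ∫ ω, ∑ b, ((X b ω) ^ 2 + (Z b ω) ^ 2) ∂μ ≤ δ / 2 * Λ :=
      mul_le_mul_of_nonneg_left hΛ (by positivity)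
    linarith
  have hZ2w : ∑ a, ∫ ω, (Z a ω) ^ 2 * w ω ∂μ ≤ Λ := by
    rw [← integral_finsetSum _ fun a _ => iZZw a]
    refine le_trans (integral_mono (integrable_finsetSum _ fun a _ => iZZw a) (integrable_finsetSum _ fun a _ => iSS a)
      fun ω => Finset.sum_le_sum fun a _ => ?_) hΛ
    have hz : (Z a ω) ^ 2 * w ω ≤ (Z a ω) ^ 2 := by
      simpa using mul_le_mul_of_nonneg_left (hwle ω) (sq_nonneg (Z a ω))
    nlinarith [sq_nonneg (X a ω)]
  have h4' : -(∑ a, ∫ ω, (Z a ω) ^ 2 * w ω ∂μ) ≤ -(s * D * (1 - δ / 2 * Λ)) + s * δ * Λ + D * η := by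
    have hsum : ∑ a : Fin D, (s * (∫ ω, w ω ∂μ) - s * δ * (∫ ω, (Z a ω) ^ 2 * w ω ∂μ) - η) ≤
        ∑ a, ∫ ω, (Z a ω) ^ 2 * w ω ∂μ := Finset.sum_le_sum fun a _ => h4 a
    rw [Finset.sum_sub_distrib, Finset.sum_sub_distrib, Finset.sum_const, Finset.card_univ, Fintype.card_fin,
      Finset.sum_const, Finset.card_univ, Fintype.card_fin, ← Finset.mul_sum] at hsum
    simp only [nsmul_eq_mul] at hsum
    have hsw : s * D * (1 - δ / 2 * Λ) ≤ (D : ℝ) * (s * ∫ ω, w ω ∂μ) := by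
      have := mul_le_mul_of_nonneg_left hwint (show 0 ≤ s * D by positivity)
      linarith
    have hsz : s * δ * ∑ a, ∫ ω, (Z a ω) ^ 2 * w ω ∂μ ≤ s * δ * Λ :=
      mul_le_mul_of_nonneg_left hZ2w (by positivity)
    linarith
  -- (5) combine
  rw [h1]
  have hD0 : (0 : ℝ) ≤ D := Nat.cast_nonneg D
  nlinarith [h2, h3', h4', hD0, hs, hδ.le]

/-- **The Stein-pair budget lemma (`L¹` form).** Under the hypotheses of `integral_sq_weight_le`, for every colour `a` and every
`λ > 0`, `E|X_a| ≤ λ·(ε_b + 3Dη + sδΛ(D/2+1)) + λ⁻¹ + √δ·Λ`. -/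
theorem integral_abs_le (hXm : ∀ a, Measurable (X a)) (hZm : ∀ a, Measurable (Z a))
    {B : ℝ} (hXb : ∀ a ω, |X a ω| ≤ B) (hZb : ∀ a ω, |Z a ω| ≤ B)
    {s δ η εb Λ : ℝ} (hs : 0 ≤ s) (hδ : 0 < δ) {w : Ω → ℝ}
    (hw : ∀ ω, w ω = Real.exp (-(δ / 2) * ∑ b, ((X b ω) ^ 2 + (Z b ω) ^ 2)))
    (hS1 : ∀ a, |(∫ ω, Z a ω * (Z a ω * w ω) ∂μ) -
        s * ∫ ω, (w ω - δ * (Z a ω) ^ 2 * w ω) ∂μ| ≤ η)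
    (hS2 : ∀ a, |(∫ ω, Z a ω * (X a ω * w ω) ∂μ) +
        s * δ * ∫ ω, X a ω * Z a ω * w ω ∂μ| ≤ η)
    (hbudget : ∫ ω, ∑ a, (X a ω + Z a ω) ^ 2 ∂μ ≤ D * s + εb)
    (hΛ : ∫ ω, ∑ a, ((X a ω) ^ 2 + (Z a ω) ^ 2) ∂μ ≤ Λ)
    (a : Fin D) {lam : ℝ} (hlam : 0 < lam) :
    ∫ ω, |X a ω| ∂μ ≤ lam * (εb + 3 * D * η + s * δ * Λ * (D / 2 + 1)) + lam⁻¹ + Real.sqrt δ * Λ := by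
  set Q : ℝ := εb + 3 * D * η + s * δ * Λ * (D / 2 + 1) with hQ
  have hmain : ∫ ω, ∑ a, (X a ω) ^ 2 * w ω ∂μ ≤ Q :=
    integral_sq_weight_le μ hXm hZm hXb hZb hs hδ hw hS1 hS2 hbudget hΛ
  have hwm : Measurable w := measurable_weight hXm hZm hw
  have hwpos : ∀ ω, 0 < w ω := weight_pos hw
  have hw1 : ∀ ω, |w ω| ≤ 1 := fun ω => by rw [abs_of_pos (hwpos ω)]; exact weight_le_one hw hδ.le ω
  -- bounded measurable functions are integrable (cf. `SelfNormalisedSkewness.Negative.integrable_of_abs_le_const`)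
  have integrable_of_bdd : ∀ {f : Ω → ℝ}, Measurable f → ∀ {C : ℝ}, (∀ ω, |f ω| ≤ C) → Integrable f μ :=
    fun hf C hC => Integrable.of_bound hf.aestronglyMeasurable C
      (ae_of_all _ fun ω => by rw [Real.norm_eq_abs]; exact hC ω)
  have hX2 : ∀ b ω, (X b ω) ^ 2 ≤ B ^ 2 := fun b ω => by
    simpa only [sq_abs] using pow_le_pow_left₀ (abs_nonneg _) (hXb b ω) 2
  have hZ2 : ∀ b ω, (Z b ω) ^ 2 ≤ B ^ 2 := fun b ω => by
    simpa only [sq_abs] using pow_le_pow_left₀ (abs_nonneg _) (hZb b ω) 2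
  have iXXw : ∀ b, Integrable (fun ω => (X b ω) ^ 2 * w ω) μ := fun b =>
    integrable_of_bdd (((hXm b).pow_const 2).mul hwm) (C := B ^ 2 * 1) fun ω => by
      rw [abs_mul, abs_of_nonneg (sq_nonneg _)]
      exact mul_le_mul (hX2 b ω) (hw1 ω) (abs_nonneg _) (sq_nonneg B)
  have iSS : ∀ b, Integrable (fun ω => (X b ω) ^ 2 + (Z b ω) ^ 2) μ := fun b =>
    integrable_of_bdd (((hXm b).pow_const 2).add ((hZm b).pow_const 2)) (C := B ^ 2 + B ^ 2) fun ω => by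
      rw [abs_of_nonneg (by positivity)]
      exact add_le_add (hX2 b ω) (hZ2 b ω)
  have iS : Integrable (fun ω => ∑ b, ((X b ω) ^ 2 + (Z b ω) ^ 2)) μ := integrable_finsetSum _ fun b _ => iSS b
  -- single colour `≤` the sum over colours
  have hXa : ∫ ω, (X a ω) ^ 2 * w ω ∂μ ≤ Q := by
    refine le_trans ?_ hmain
    refine integral_mono (iXXw a) (integrable_finsetSum _ fun b _ => iXXw b) fun ω => ?_
    exact Finset.single_le_sum (f := fun b => (X b ω) ^ 2 * w ω)
      (fun b _ => mul_nonneg (sq_nonneg _) (hwpos ω).le) (Finset.mem_univ a)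
  -- pointwise: `|x_a| ≤ e^{1/4}|x_a|√w + √δ Σ` and AM–GM `2|x_a|√w ≤ lam x_a² w + lam⁻¹` (`e^{1/4} ≤ 2`)
  have hpt : ∀ ω, |X a ω| ≤ lam * ((X a ω) ^ 2 * w ω) + lam⁻¹ +
      Real.sqrt δ * ∑ b, ((X b ω) ^ 2 + (Z b ω) ^ 2) := by
    intro ω
    have h0 := abs_le_weighted_add hw hδ a ω
    set t : ℝ := |X a ω| * Real.sqrt (w ω) with ht
    have hsq : t ^ 2 = (X a ω) ^ 2 * w ω := by
      rw [ht, mul_pow, sq_abs, Real.sq_sqrt (hwpos ω).le]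
    have hamgm : 2 * t ≤ lam * ((X a ω) ^ 2 * w ω) + lam⁻¹ := by
      have key : lam * ((X a ω) ^ 2 * w ω) + lam⁻¹ - 2 * t = lam * (t - lam⁻¹) ^ 2 := by
        rw [← hsq]; field_simp; ring
      have : 0 ≤ lam * (t - lam⁻¹) ^ 2 := by positivity
      linarith
    have hnn : 0 ≤ t := by positivity
    have he := mul_le_mul_of_nonneg_right exp_quarter_le_two hnn
    linarith
  have iabs : Integrable (fun ω => |X a ω|) μ :=
    integrable_of_bdd (hXm a).abs (C := B) fun ω => by rw [abs_abs]; exact hXb a ω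
  have i1 : Integrable (fun ω => lam * ((X a ω) ^ 2 * w ω)) μ := (iXXw a).const_mul lam
  have i12 : Integrable (fun ω => lam * ((X a ω) ^ 2 * w ω) + lam⁻¹) μ := i1.add (integrable_const _)
  have i3 : Integrable (fun ω => Real.sqrt δ * ∑ b, ((X b ω) ^ 2 + (Z b ω) ^ 2)) μ := iS.const_mul _
  have irhs : Integrable (fun ω => lam * ((X a ω) ^ 2 * w ω) + lam⁻¹ +
      Real.sqrt δ * ∑ b, ((X b ω) ^ 2 + (Z b ω) ^ 2)) μ := i12.add i3
  have hE : ∫ ω, (lam * ((X a ω) ^ 2 * w ω) + lam⁻¹ + Real.sqrt δ * ∑ b, ((X b ω) ^ 2 + (Z b ω) ^ 2)) ∂μ =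
      lam * (∫ ω, (X a ω) ^ 2 * w ω ∂μ) + lam⁻¹ + Real.sqrt δ * ∫ ω, ∑ b, ((X b ω) ^ 2 + (Z b ω) ^ 2) ∂μ := by
    rw [integral_add i12 i3, integral_add i1 (integrable_const _), integral_const_mul, integral_const_mul,
      integral_const]
    simp
  calc ∫ ω, |X a ω| ∂μ ≤ ∫ ω, (lam * ((X a ω) ^ 2 * w ω) + lam⁻¹ +
        Real.sqrt δ * ∑ b, ((X b ω) ^ 2 + (Z b ω) ^ 2)) ∂μ := integral_mono iabs irhs hpt
    _ = lam * (∫ ω, (X a ω) ^ 2 * w ω ∂μ) + lam⁻¹ +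
        Real.sqrt δ * ∫ ω, ∑ b, ((X b ω) ^ 2 + (Z b ω) ^ 2) ∂μ := hE
    _ ≤ lam * Q + lam⁻¹ + Real.sqrt δ * Λ := by
      have h1 := mul_le_mul_of_nonneg_left hXa hlam.le
      have h2 := mul_le_mul_of_nonneg_left hΛ (Real.sqrt_nonneg δ)
      linarith

end Integral

end SteinPair

end Summit.QuantumFields.YangMills.Cruxes.FreeProbeLawG.SteinFree

end
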